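import Mathlib
import HarnessLib
import Summits.KontsevichZagierPeriods.Zeta5Search.TwoTaleWhippleBinomial

/-!
# TwoTaleWhippleRemark5Terms — the k-centric factorial dictionary for Zudilin's Remark 5 (core identities)

HONEST FRAMING: systematic search; no irrationality claim unless certified.  Identities between finite products and
binomials over `ℤ`; nothing about `ζ(2)` / `ζ(5)`, no measure; 0 kit.

Cell pub-zeta5, seat ct-1 g26 (lead ruling INBOX l.9151).  First half of the proof of the node
`TwoTaleWhipple.WhippleRemark5` for ALL admissible data (second half: `TwoTaleWhippleRemark5Full`).  Whipple's
transformation in the polynomial form (W) of `HypergeometricWhipple` has, at Zudilin's integer parameters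
`f = a₄, h = a₄−a₁+1, a = a₄−a₁−a₂+1, g = a₄−a₃+1, N = b₄−a₄−1`, lower rising factorials at NON-positive integers as
soon as the datum leaves the cone `a₁, a₂, a₃ ≤ a₄`; the cure is to index both tales by the pole `k` and to pass to
the k-centric NATURAL coordinates `n = k−a₄, m = b₄−1−k, p = k−a₁, q = k−a₂, s = k−a₃, t = k+a₃−a₄−1, w = 2k−â₀,
v = a₁+a₂−1−k, Aᵢ = aᵢ−1, E = a₁+a₂−a₄−1, E' = a₂+a₃−a₄−1, B₃ = b₄−a₃−1`, in which every rising factorial of (W)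
clears to the factorial of a natural number:

* `rf_succ_mul_factorial`, `rf_neg_add_mul_factorial`, `rf_eq_zero_of_nonpos` — `(p+1)_m·p! = (p+m)!`,
  `(−(w+m))_m·w! = (−1)^m (w+m)!`, and a rising factorial through zero vanishes;
* `core_first` — `A₄!·A₂!·nearlyPoisedTerm = (−1)^{A₁+E+E'}·(p+m)!(q+m)!(s+m)!·E!·E'!·[(−1)^n C(N,n)·∏ (−1)^{mⱼ} C(·,mⱼ)]`
  (the bracket is the first-tale coefficient `C_k` of [Zudilin2014ZetaTwo, (P2)] in these coordinates);
* `core_second` — `A₄!·A₂!·saalschutzianTerm = (−1)^{n+m}·(p+m)!(q+m)!·B₃!·E!·E'!·[C(A₄+2n,B₃) C(t,E') C(A₂,p) C(N,n)]`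
  (the bracket is the unsigned second-tale coefficient `A_k` of [Zudilin2014ZetaTwo, (T2)]);
* `npt_eq_zero_of_h/mid/g`, `st_eq_zero_of_h/mid/a/g` — the vanishing of either term when one of its blocks passes
  through zero (the pole indices outside the summation ranges, and the guard `2k < â₀` of (T2)).

Checked in exact arithmetic beforehand (`HOME/ct-1/g26/code/remark5_full_check.py`, 14 161 admissible data,
0 failures).  Theorems only (no new definitions).
-/

namespace Summit.KontsevichZagierPeriods.Zeta5Search.TwoTaleWhippleRemark5Terms

open Finset Nat
open Summit.KontsevichZagierPeriods.Zeta5Search.HypergeometricWhipple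
open Summit.KontsevichZagierPeriods.Zeta5Search.TwoTaleWhippleBinomial (rf_natCast_succ)

/-! ### Rising factorials at integers, cleared of denominators -/

/-- `(p+1)_m · p! = (p+m)!` over `ℤ`. -/
theorem rf_succ_mul_factorial (p m : ℕ) :
    rf ((p : ℤ) + 1) m * (p ! : ℤ) = ((p + m)! : ℤ) := by
  rw [rf_natCast_succ, mul_comm]
  exact_mod_cast Nat.factorial_mul_ascFactorial p m

/-- `(−(w+m))_m · w! = (−1)^m (w+m)!` over `ℤ` (a falling block read downwards). -/
theorem rf_neg_add_mul_factorial (w m : ℕ) :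
    rf (-((w : ℤ) + m)) m * (w ! : ℤ) = (-1) ^ m * ((w + m)! : ℤ) := by
  have h := rf_reflect (R := ℤ) ((w : ℤ) + 1) m
  rw [show (1 - ((w : ℤ) + 1) - (m : ℤ)) = -((w : ℤ) + m) by ring] at h
  rw [h, mul_assoc, rf_succ_mul_factorial]

/-- A rising factorial through zero vanishes: `(z)_m = 0` if `z ≤ 0 < z + m`. -/
theorem rf_eq_zero_of_nonpos {z : ℤ} {m : ℕ} (hz : z ≤ 0) (hm : 0 < z + m) : rf z m = 0 := by
  unfold rf
  exact Finset.prod_eq_zero (i := (-z).toNat) (by rw [mem_range]; omega) (by omega)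

/-- `C(i+j, j) · i! · j! = (i+j)!` cast to `ℤ`. -/
theorem choose_mul_factorial_cast (i j : ℕ) :
    (((i + j).choose j : ℕ) : ℤ) * (i ! : ℤ) * (j ! : ℤ) = ((i + j)! : ℤ) := by
  exact_mod_cast Nat.add_choose_mul_factorial_mul_factorial i j

/-! ### Core termwise identity, nearly-poised (first-tale) side

Natural coordinates at the pole `k`: `A_i = a_i − 1`, `n = k − a₄`, `m = b₄ − 1 − k`, `p = k − a₁`, `q = k − a₂`,
`s = k − a₃`, `E = a₁+a₂−a₄−1`, `E' = a₂+a₃−a₄−1`. -/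

/-- **(E1) core.** `A₄!·A₂!·nearlyPoisedTerm = (−1)^{A₁+E+E'}·(p+m)!(q+m)!(s+m)!·E!·E'!·[binomial form of C_k]`. -/
theorem core_first (A1 A2 A4 E E' n m p q s : ℕ) (h1 : A4 + n = A1 + p) (h2 : A1 + n = E + q)
    (h3 : A2 + n = E' + s) (h4 : A1 + A2 = A4 + E) :
    (A4 ! : ℤ) * (A2 ! : ℤ) *
        nearlyPoisedTerm ((A4 : ℤ) + 1) ((p : ℤ) - n + 1) (-(E : ℤ)) ((s : ℤ) - n + 1) (n + m) n =
      (-1) ^ (A1 + E + E') * (((p + m)! : ℤ) * ((q + m)! : ℤ) * ((s + m)! : ℤ) * (E ! : ℤ) * (E' ! : ℤ)) *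
        ((-1) ^ n * (((n + m).choose n : ℕ) : ℤ) *
          ((-1) ^ A1 * (((A4 + n).choose A1 : ℕ) : ℤ)) * ((-1) ^ E * (((A1 + n).choose E : ℕ) : ℤ)) *
          ((-1) ^ E' * (((A2 + n).choose E' : ℕ) : ℤ))) := by
  -- the six rising factorials of the nearly-poised term, in natural coordinates
  have e1 : rf ((A4 : ℤ) + 1) n * (A4 ! : ℤ) = ((A4 + n)! : ℤ) := rf_succ_mul_factorial A4 n
  have e2 : rf ((A1 : ℤ) + 1) n * (A1 ! : ℤ) = ((A1 + n)! : ℤ) := rf_succ_mul_factorial A1 n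
  have e3 : rf ((A2 : ℤ) + 1) n * (A2 ! : ℤ) = ((A2 + n)! : ℤ) := rf_succ_mul_factorial A2 n
  have e4 : rf ((p : ℤ) + 1) m * (p ! : ℤ) = ((p + m)! : ℤ) := rf_succ_mul_factorial p m
  have e5 : rf ((q : ℤ) + 1) m * (q ! : ℤ) = ((q + m)! : ℤ) := rf_succ_mul_factorial q m
  have e6 : rf ((s : ℤ) + 1) m * (s ! : ℤ) = ((s + m)! : ℤ) := rf_succ_mul_factorial s m
  -- the three binomials of `C_k`
  have c1 : (((A4 + n).choose A1 : ℕ) : ℤ) * (p ! : ℤ) * (A1 ! : ℤ) = ((A4 + n)! : ℤ) := by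
    rw [h1, show A1 + p = p + A1 by ring]; exact choose_mul_factorial_cast p A1
  have c2 : (((A1 + n).choose E : ℕ) : ℤ) * (q ! : ℤ) * (E ! : ℤ) = ((A1 + n)! : ℤ) := by
    rw [h2, show E + q = q + E by ring]; exact choose_mul_factorial_cast q E
  have c3 : (((A2 + n).choose E' : ℕ) : ℤ) * (s ! : ℤ) * (E' ! : ℤ) = ((A2 + n)! : ℤ) := by
    rw [h3, show E' + s = s + E' by ring]; exact choose_mul_factorial_cast s E'
  -- rewrite the parameters of the nearly-poised term
  have hp1 : (1 + ((A4 : ℤ) + 1) - ((p : ℤ) - n + 1)) = (A1 : ℤ) + 1 := by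
    have : ((A4 : ℤ) + n) = A1 + p := by exact_mod_cast h1
    linarith
  have hp2 : (((p : ℤ) - n + 1) - -(E : ℤ)) = (A2 : ℤ) + 1 := by
    have h1' : ((A4 : ℤ) + n) = A1 + p := by exact_mod_cast h1
    have h4' : ((A1 : ℤ) + A2) = A4 + E := by exact_mod_cast h4
    linarith
  have hp3 : (((p : ℤ) - n + 1) + (n : ℕ)) = (p : ℤ) + 1 := by ring
  have hp4 : (1 + ((A4 : ℤ) + 1) + -(E : ℤ) - ((p : ℤ) - n + 1) + (n : ℕ)) = (q : ℤ) + 1 := by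
    have h1' : ((A4 : ℤ) + n) = A1 + p := by exact_mod_cast h1
    have h2' : ((A1 : ℤ) + n) = E + q := by exact_mod_cast h2
    linarith
  have hp5 : (((s : ℤ) - n + 1) + (n : ℕ)) = (s : ℤ) + 1 := by ring
  have hNn : n + m - n = m := by omega
  -- cancel `A1! p! q! s!`
  have hP : (A1 ! : ℤ) * (p ! : ℤ) * (q ! : ℤ) * (s ! : ℤ) ≠ 0 := by positivity
  refine mul_right_cancel₀ hP ?_
  have sq : ((-1 : ℤ) ^ (A1 + E + E')) * ((-1) ^ A1 * (-1) ^ E * (-1) ^ E') = 1 := by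
    rw [← pow_add, ← pow_add, ← pow_add, ← two_mul, pow_mul, neg_one_sq, one_pow]
  unfold nearlyPoisedTerm
  rw [hp1, hp2, hp3, hp4, hp5, hNn]
  calc (A4 ! : ℤ) * (A2 ! : ℤ) * ((-1) ^ n * (((n + m).choose n : ℕ) : ℤ) * rf ((A4 : ℤ) + 1) n *
          rf ((A1 : ℤ) + 1) n * rf ((A2 : ℤ) + 1) n * rf ((p : ℤ) + 1) m * rf ((q : ℤ) + 1) m * rf ((s : ℤ) + 1) m) *
          ((A1 ! : ℤ) * (p ! : ℤ) * (q ! : ℤ) * (s ! : ℤ))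
      = (-1) ^ n * (((n + m).choose n : ℕ) : ℤ) * (rf ((A4 : ℤ) + 1) n * (A4 ! : ℤ)) *
          (rf ((A1 : ℤ) + 1) n * (A1 ! : ℤ)) * (rf ((A2 : ℤ) + 1) n * (A2 ! : ℤ)) *
          (rf ((p : ℤ) + 1) m * (p ! : ℤ)) * (rf ((q : ℤ) + 1) m * (q ! : ℤ)) * (rf ((s : ℤ) + 1) m * (s ! : ℤ)) := by
        ring
    _ = (-1) ^ n * (((n + m).choose n : ℕ) : ℤ) * ((A4 + n)! : ℤ) * ((A1 + n)! : ℤ) * ((A2 + n)! : ℤ) *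
          ((p + m)! : ℤ) * ((q + m)! : ℤ) * ((s + m)! : ℤ) := by rw [e1, e2, e3, e4, e5, e6]
    _ = (((-1 : ℤ) ^ (A1 + E + E')) * ((-1) ^ A1 * (-1) ^ E * (-1) ^ E')) *
          ((-1) ^ n * (((n + m).choose n : ℕ) : ℤ) * ((p + m)! : ℤ) * ((q + m)! : ℤ) * ((s + m)! : ℤ) *
          ((((A4 + n).choose A1 : ℕ) : ℤ) * (p ! : ℤ) * (A1 ! : ℤ)) *
          ((((A1 + n).choose E : ℕ) : ℤ) * (q ! : ℤ) * (E ! : ℤ)) *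
          ((((A2 + n).choose E' : ℕ) : ℤ) * (s ! : ℤ) * (E' ! : ℤ))) := by rw [sq, c1, c2, c3]; ring
    _ = _ := by ring

/-! ### Core termwise identity, Saalschützian (second-tale) side

Further natural coordinates: `t = k + a₃ − a₄ − 1`, `w = 2k − â₀`, `v = a₁ + a₂ − 1 − k`, `B₃ = b₄ − a₃ − 1`. -/

/-- **(E2) core.** `A₄!·A₂!·saalschutzianTerm = (−1)^{n+m}·(p+m)!(q+m)!·B₃!·E!·E'!·[binomial form of A_k]`. -/
theorem core_second (A2 A4 E E' B3 n m p q t w v : ℕ) (h1 : A4 + 2 * n = B3 + w) (h2 : t = E' + q)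
    (h3 : A2 = p + v) (h4 : E = n + v) (h5 : t = w + m) (h6 : A2 + q = A4 + n) :
    (A4 ! : ℤ) * (A2 ! : ℤ) *
        saalschutzianTerm ((A4 : ℤ) + 1) ((p : ℤ) - n + 1) (-(E : ℤ)) ((A4 : ℤ) + 1 + n - t) (n + m) n =
      (-1) ^ (n + m) * (((p + m)! : ℤ) * ((q + m)! : ℤ) * (B3 ! : ℤ) * (E ! : ℤ) * (E' ! : ℤ)) *
        ((((A4 + 2 * n).choose B3 : ℕ) : ℤ) * ((t.choose E' : ℕ) : ℤ) * ((A2.choose p : ℕ) : ℤ) *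
          (((n + m).choose n : ℕ) : ℤ)) := by
  have e1 : rf (-(E : ℤ)) n * (v ! : ℤ) = (-1) ^ n * (E ! : ℤ) := by
    rw [h4, show (((n + v : ℕ) : ℤ)) = (v : ℤ) + n by push_cast; ring, rf_neg_add_mul_factorial v n,
      show v + n = n + v by ring]
  have e2 : rf ((A4 : ℤ) + 1) (2 * n) * (A4 ! : ℤ) = ((A4 + 2 * n)! : ℤ) := rf_succ_mul_factorial A4 (2 * n)
  have e3 : rf (-(t : ℤ)) m * (w ! : ℤ) = (-1) ^ m * (t ! : ℤ) := by
    rw [h5, show (((w + m : ℕ) : ℤ)) = (w : ℤ) + m by push_cast; ring, rf_neg_add_mul_factorial w m]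
  have e4 : rf ((p : ℤ) + 1) m * (p ! : ℤ) = ((p + m)! : ℤ) := rf_succ_mul_factorial p m
  have e5 : rf ((q : ℤ) + 1) m * (q ! : ℤ) = ((q + m)! : ℤ) := rf_succ_mul_factorial q m
  have c1 : (((A4 + 2 * n).choose B3 : ℕ) : ℤ) * (w ! : ℤ) * (B3 ! : ℤ) = ((A4 + 2 * n)! : ℤ) := by
    rw [h1, show B3 + w = w + B3 by ring]; exact choose_mul_factorial_cast w B3
  have c2 : ((t.choose E' : ℕ) : ℤ) * (q ! : ℤ) * (E' ! : ℤ) = (t ! : ℤ) := by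
    rw [h2, show E' + q = q + E' by ring]; exact choose_mul_factorial_cast q E'
  have c3 : ((A2.choose p : ℕ) : ℤ) * (v ! : ℤ) * (p ! : ℤ) = (A2 ! : ℤ) := by
    rw [h3, show p + v = v + p by ring]; exact choose_mul_factorial_cast v p
  -- parameters of the Saalschützian term
  have hp1 : (((A4 : ℤ) + 1 + n - t) - ((A4 : ℤ) + 1) - (n : ℕ)) = -(t : ℤ) := by ring
  have hp2 : (((p : ℤ) - n + 1) + (n : ℕ)) = (p : ℤ) + 1 := by ring
  have hp3 : (1 + ((A4 : ℤ) + 1) + -(E : ℤ) - ((p : ℤ) - n + 1) + (n : ℕ)) = (q : ℤ) + 1 := by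
    have h3' : (A2 : ℤ) = p + v := by exact_mod_cast h3
    have h4' : (E : ℤ) = n + v := by exact_mod_cast h4
    have h6' : ((A2 : ℤ) + q) = A4 + n := by exact_mod_cast h6
    linarith
  have hNn : n + m - n = m := by omega
  have hP : (v ! : ℤ) * (w ! : ℤ) * (p ! : ℤ) * (q ! : ℤ) ≠ 0 := by positivity
  refine mul_right_cancel₀ hP ?_
  unfold saalschutzianTerm
  rw [hp1, hp2, hp3, hNn]
  calc (A4 ! : ℤ) * (A2 ! : ℤ) * ((((n + m).choose n : ℕ) : ℤ) * rf (-(E : ℤ)) n * rf ((A4 : ℤ) + 1) (2 * n) *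
          rf (-(t : ℤ)) m * rf ((p : ℤ) + 1) m * rf ((q : ℤ) + 1) m) * ((v ! : ℤ) * (w ! : ℤ) * (p ! : ℤ) * (q ! : ℤ))
      = (A2 ! : ℤ) * (((n + m).choose n : ℕ) : ℤ) * (rf (-(E : ℤ)) n * (v ! : ℤ)) * (rf ((A4 : ℤ) + 1) (2 * n) * (A4 ! : ℤ)) *
          (rf (-(t : ℤ)) m * (w ! : ℤ)) * (rf ((p : ℤ) + 1) m * (p ! : ℤ)) * (rf ((q : ℤ) + 1) m * (q ! : ℤ)) := by ring
    _ = (A2 ! : ℤ) * (((n + m).choose n : ℕ) : ℤ) * ((-1) ^ n * (E ! : ℤ)) * ((A4 + 2 * n)! : ℤ) *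
          ((-1) ^ m * (t ! : ℤ)) * ((p + m)! : ℤ) * ((q + m)! : ℤ) := by rw [e1, e2, e3, e4, e5]
    _ = (-1) ^ (n + m) * (((p + m)! : ℤ) * ((q + m)! : ℤ) * (E ! : ℤ)) * (((n + m).choose n : ℕ) : ℤ) *
          ((((A4 + 2 * n).choose B3 : ℕ) : ℤ) * (w ! : ℤ) * (B3 ! : ℤ)) *
          (((t.choose E' : ℕ) : ℤ) * (q ! : ℤ) * (E' ! : ℤ)) *
          (((A2.choose p : ℕ) : ℤ) * (v ! : ℤ) * (p ! : ℤ)) := by rw [c1, c2, c3, pow_add]; ring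
    _ = _ := by ring

/-! ### Splitting an integer interval sum -/

/-- `Σ_{[a,c)} = Σ_{[a,b)} + Σ_{[b,c)}` for `a ≤ b ≤ c` (integer intervals). -/
theorem sum_Ico_split (f : ℤ → ℤ) {a b c : ℤ} (hab : a ≤ b) (hbc : b ≤ c) :
    ∑ k ∈ Ico a c, f k = ∑ k ∈ Ico a b, f k + ∑ k ∈ Ico b c, f k := by
  rw [← Finset.Ico_union_Ico_eq_Ico hab hbc, Finset.sum_union (Finset.Ico_disjoint_Ico_consecutive a b c)]

/-! ### Vanishing of the two hypergeometric terms outside the pole ranges -/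

section vanishing

variable (f h a g : ℤ) (N n : ℕ)

/-- The nearly-poised term vanishes when the block `(h+n)_{N−n}` passes through zero. -/
theorem npt_eq_zero_of_h (h1 : h + n ≤ 0) (h2 : 0 < h + N) (hn : n ≤ N) : nearlyPoisedTerm f h a g N n = 0 := by
  have hz : rf (h + n) (N - n) = 0 := rf_eq_zero_of_nonpos h1 (by push_cast [Nat.cast_sub hn]; linarith)
  unfold nearlyPoisedTerm; rw [hz]; ring

/-- The nearly-poised term vanishes when the block `(1+f+a−h+n)_{N−n}` passes through zero. -/
theorem npt_eq_zero_of_mid (h1 : 1 + f + a - h + n ≤ 0) (h2 : 0 < 1 + f + a - h + N) (hn : n ≤ N) :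
    nearlyPoisedTerm f h a g N n = 0 := by
  have hz : rf (1 + f + a - h + n) (N - n) = 0 :=
    rf_eq_zero_of_nonpos h1 (by push_cast [Nat.cast_sub hn]; linarith)
  unfold nearlyPoisedTerm; rw [hz]; ring

/-- The nearly-poised term vanishes when the block `(g+n)_{N−n}` passes through zero. -/
theorem npt_eq_zero_of_g (h1 : g + n ≤ 0) (h2 : 0 < g + N) (hn : n ≤ N) : nearlyPoisedTerm f h a g N n = 0 := by
  have hz : rf (g + n) (N - n) = 0 := rf_eq_zero_of_nonpos h1 (by push_cast [Nat.cast_sub hn]; linarith)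
  unfold nearlyPoisedTerm; rw [hz]; ring

/-- The Saalschützian term vanishes when `(h+r)_{N−r}` passes through zero. -/
theorem st_eq_zero_of_h (h1 : h + n ≤ 0) (h2 : 0 < h + N) (hn : n ≤ N) : saalschutzianTerm f h a g N n = 0 := by
  have hz : rf (h + n) (N - n) = 0 := rf_eq_zero_of_nonpos h1 (by push_cast [Nat.cast_sub hn]; linarith)
  unfold saalschutzianTerm; rw [hz]; ring

/-- The Saalschützian term vanishes when `(1+f+a−h+r)_{N−r}` passes through zero. -/
theorem st_eq_zero_of_mid (h1 : 1 + f + a - h + n ≤ 0) (h2 : 0 < 1 + f + a - h + N) (hn : n ≤ N) :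
    saalschutzianTerm f h a g N n = 0 := by
  have hz : rf (1 + f + a - h + n) (N - n) = 0 :=
    rf_eq_zero_of_nonpos h1 (by push_cast [Nat.cast_sub hn]; linarith)
  unfold saalschutzianTerm; rw [hz]; ring

/-- The Saalschützian term vanishes when `(a)_r` passes through zero (`a ≤ 0 < a + r`). -/
theorem st_eq_zero_of_a (h1 : a ≤ 0) (h2 : 0 < a + n) : saalschutzianTerm f h a g N n = 0 := by
  have hz : rf a n = 0 := rf_eq_zero_of_nonpos h1 h2
  unfold saalschutzianTerm; rw [hz]; ring

/-- The Saalschützian term vanishes when `(g−f−r)_{N−r}` passes through zero. -/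
theorem st_eq_zero_of_g (h1 : g - f - n ≤ 0) (h2 : (n : ℤ) < g - f - n + N) (hn : n ≤ N) :
    saalschutzianTerm f h a g N n = 0 := by
  have hz : rf (g - f - n) (N - n) = 0 := rf_eq_zero_of_nonpos h1 (by push_cast [Nat.cast_sub hn]; linarith)
  unfold saalschutzianTerm; rw [hz]; ring

end vanishing

end Summit.KontsevichZagierPeriods.Zeta5Search.TwoTaleWhippleRemark5Terms
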